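import Mathlib
import Summits.BirchSwinnertonDyer.BirchSwinnertonDyer.Theorems.ResidualThetaTransportAtTwoSignedMuSeedAtTwoPlusNonsquareDescentFreeness
import Summits.BirchSwinnertonDyer.BirchSwinnertonDyer.Theorems.ResidualThetaTransportAtTwoSignedMuSeedAtTwoPlusNonsquareDescentEngine
import HarnessLib

/-!
# Non-square descent — FINITE-LAYER BOOKKEEPING: `X^{dim} ` kills every vector, and `#invariants = #co-invariants` (line card
# `nonsquare-descent`, stubs S2/S3, precision P3) for the seed crux `SignedMuSeedAtTwoPlus` stmt-BirchSwinnertonDyer-21438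
# (parent Kμ⁺ `SignedMuVanishingAtTwoPlus` stmt-BirchSwinnertonDyer-20689, route ResidualThetaTransportAtTwo)

Cell `bsd-wall`, width seat `bsd-wall-rtt-p4-w2` g17 (`--supports`, closes nothing).  THEOREMS ONLY; BSD is not proved by this; nothing
arithmetic is asserted.  Two counting facts about FINITE layers used silently in `Cruxes/SignedMuSeedAtTwoPlus/Lines/nonsquare-descent.md`:

* §1 **`X_pow_finrank_smul_eq_zero`** — in a `k⟦X⟧`-module `V` of finite `k`-dimension `N` (`k` a field), `X^N • y = 0` for EVERY `y`
  (the `N + 1` vectors `y, Xy, …, X^N y` are dependent; the resulting non-zero polynomial is `X^a·unit` with `a ≤ N`).  This discharges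
  the hypothesis `hy0 : X^{2ⁿ} • ȳ_n = 0` of `smul_eq_zero_iff_of_cyclic_of_finrank_eq` / `smul_ne_zero_iff_order_lt_of_cyclic`
  (`Theorems/…NonsquareDescentCyclicLayer.lean`), so that the P3 criterion «GNS(n) ⟺ λ < 2ⁿ» needs ONLY «`V_n` cyclic of dimension `2ⁿ`»;
  `coe_sum_C_mul_X_pow_smul` is the evaluation identity `(∑ cᵢ Xⁱ) • y = ∑ cᵢ • Xⁱ • y`.
* §2 **`natCard_torsionBy_eq_natCard_quotient_smul_top`** — for a FINITE module `B` and a scalar `a`: `#B[a] = #(B/aB)` (kernel and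
  cokernel of an endomorphism of a finite module have the same size); with the freeness descent
  (`Theorems/…NonsquareDescentFreeness.lean`, `natCard_torsionBy_quotient_eq`): **`natCard_quotient_smul_top_quotient_eq`** —
  `#(B'_m / ω_n B'_m) = #B'_n` for every `m ≥ n` (the co-invariant counts of the finite layers are CONSTANT in `m`, the form in which
  `B'_n` is compared with `Q'/ω_n Q'` in the card's chain (4)).

[folklore]
-/

set_option autoImplicit false
-- the Theorems namespace of this sub repeats the summit name by design (D-0017 nested layout)
set_option linter.dupNamespace false

open scoped Pointwise nonZeroDivisors

namespace Summit.BirchSwinnertonDyer.BirchSwinnertonDyer.Theorems.SignedMuAtTwo.NonsquareDescent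

/-! ## §1 `X^{dim_k V}` kills every vector of a finite-dimensional `k⟦X⟧`-module -/

section FiniteLayer

variable {k : Type*} [Field k] {V : Type*} [AddCommGroup V] [Module (PowerSeries k) V] [Module k V]
  [IsScalarTower k (PowerSeries k) V]

/-- `(∑ᵢ C cᵢ · Xⁱ) • y = ∑ᵢ cᵢ • (Xⁱ • y)` for a polynomial acting through `k⟦X⟧`. [folklore] -/
theorem coe_sum_C_mul_X_pow_smul (n : ℕ) (c : Fin n → k) (y : V) :
    ((∑ i, Polynomial.C (c i) * Polynomial.X ^ (i : ℕ) : Polynomial k) : PowerSeries k) • y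
      = ∑ i, c i • ((PowerSeries.X : PowerSeries k) ^ (i : ℕ) • y) := by
  rw [← Polynomial.eval₂_C_X_eq_coe, Polynomial.eval₂_finsetSum, Finset.sum_smul]
  refine Finset.sum_congr rfl fun i _ => ?_
  rw [Polynomial.eval₂_mul, Polynomial.eval₂_C, Polynomial.eval₂_X_pow, mul_smul, PowerSeries.C_eq_algebraMap,
    algebraMap_smul]

/-- **`X^{finrank_k V} • y = 0`** for every `y` in a finite-dimensional `k⟦X⟧`-module. [folklore] -/
theorem X_pow_finrank_smul_eq_zero [Module.Finite k V] (y : V) :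
    (PowerSeries.X : PowerSeries k) ^ (Module.finrank k V) • y = 0 := by
  set N := Module.finrank k V with hN
  have hdep : ¬ LinearIndependent k (fun i : Fin (N + 1) => (PowerSeries.X : PowerSeries k) ^ (i : ℕ) • y) := by
    intro h
    have hle := h.fintype_card_le_finrank
    rw [Fintype.card_fin] at hle
    omega
  rw [Fintype.not_linearIndependent_iff] at hdep
  obtain ⟨c, hc, i₀, hi₀⟩ := hdep
  set p : Polynomial k := ∑ i, Polynomial.C (c i) * Polynomial.X ^ (i : ℕ) with hp
  have hpy : (p : PowerSeries k) • y = 0 := by rw [hp, coe_sum_C_mul_X_pow_smul, hc]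
  have hcoeff : ∀ j : Fin (N + 1), p.coeff (j : ℕ) = c j := by
    intro j
    rw [hp, Polynomial.finsetSum_coeff, Finset.sum_eq_single j, Polynomial.coeff_C_mul_X_pow, if_pos rfl]
    · intro b _ hb
      rw [Polynomial.coeff_C_mul_X_pow, if_neg (fun h => hb (Fin.ext h).symm)]
    · intro h
      exact absurd (Finset.mem_univ j) h
  have hp0 : (p : PowerSeries k) ≠ 0 := by
    rw [Ne, Polynomial.coe_eq_zero_iff]
    intro h0
    apply hi₀
    rw [← hcoeff i₀, h0, Polynomial.coeff_zero]
  obtain ⟨a, w, hw, hpw⟩ := powerSeries_eq_X_pow_mul_unit (p : PowerSeries k) hp0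
  have hXa : (PowerSeries.X : PowerSeries k) ^ a • y = 0 := by
    rw [hpw, mul_comm, mul_smul, hw.smul_eq_zero] at hpy
    exact hpy
  have hi₀N := i₀.is_lt
  have ha : a ≤ N := by
    by_contra hlt
    push Not at hlt
    have hdvd : (PowerSeries.X : PowerSeries k) ^ a ∣ (p : PowerSeries k) := ⟨w, hpw⟩
    rw [PowerSeries.X_pow_dvd_iff] at hdvd
    have h0 := hdvd i₀ (by omega)
    rw [Polynomial.coeff_coe, hcoeff] at h0
    exact hi₀ h0
  rw [show N = (N - a) + a by omega, pow_add, mul_smul, hXa, smul_zero]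

/-- Variant with the dimension named: `finrank_k V = N ⇒ X^N • y = 0`. [folklore] -/
theorem X_pow_smul_eq_zero_of_finrank_eq [Module.Finite k V] {N : ℕ} (hN : Module.finrank k V = N) (y : V) :
    (PowerSeries.X : PowerSeries k) ^ N • y = 0 := by
  rw [← hN]
  exact X_pow_finrank_smul_eq_zero y

end FiniteLayer

/-! ## §2 `#B[a] = #(B/aB)` for a finite module, and `#(B'_m/ω_n B'_m) = #B'_n` -/

section Counts

variable {R : Type*} [CommRing R] {B : Type*} [AddCommGroup B] [Module R B]

/-- **Kernel and cokernel of multiplication by `a` on a FINITE module have the same size**: `#B[a] = #(B/aB)`. [folklore] -/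
theorem natCard_torsionBy_eq_natCard_quotient_smul_top [Finite B] (a : R) :
    Nat.card (Submodule.torsionBy R B a) = Nat.card (B ⧸ (a • (⊤ : Submodule R B))) := by
  set f : B →ₗ[R] B := DistribSMul.toLinearMap R B a with hf
  have hker : LinearMap.ker f = Submodule.torsionBy R B a := rfl
  have hrange : LinearMap.range f = a • (⊤ : Submodule R B) := by
    rw [Submodule.pointwise_smul_def, Submodule.map_top]
  have h1 := Submodule.card_eq_card_quotient_mul_card (LinearMap.ker f)
  have h2 := Submodule.card_eq_card_quotient_mul_card (LinearMap.range f)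
  have h3 : Nat.card (B ⧸ LinearMap.ker f) = Nat.card (LinearMap.range f) :=
    Nat.card_congr f.quotKerEquivRange.toEquiv
  have hpos : 0 < Nat.card (LinearMap.range f) := Nat.card_pos
  rw [← hker, ← hrange]
  rw [h3] at h1
  rw [h1, mul_comm] at h2
  exact Nat.eq_of_mul_eq_mul_left hpos h2

variable {E : Type*} [AddCommGroup E] [Module R E] {En : Type*} [AddCommGroup En] [Module R En]

/-- **`#(B'_m / ω_n B'_m) = #B'_n` (`m ≥ n`)**: under the hypotheses of the freeness descent (`Theorems/…NonsquareDescentFreeness.lean`,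
`natCard_torsionBy_quotient_eq`: `#(B'_m)^{G_{m,n}} = #B'_n`) and finiteness of `B'_m = E ⧸ R∙u`, the co-invariants have the same count:
`#((E ⧸ R∙u) ⧸ ω) = #(En ⧸ R∙un)`. [folklore] -/
theorem natCard_quotient_smul_top_quotient_eq {ν ω : R} (hω : ω ∈ R⁰) (hν : ν ∈ R⁰)
    (hE : ∀ x : E, (ν * ω) • x = 0) {u : E} (hu : ∀ r : R, r • u = 0 → ν * ω ∣ r)
    (j : En →ₗ[R] E) (hj : Function.Injective j) (hjω : ∀ x : En, ω • j x = 0)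
    (hjr : ∀ e : E, ω • e = 0 → e ∈ LinearMap.range j) {un : En} (hun : j un = ν • u)
    [Finite (E ⧸ Submodule.span R {u})] :
    Nat.card ((E ⧸ Submodule.span R {u}) ⧸ (ω • (⊤ : Submodule R (E ⧸ Submodule.span R {u}))))
      = Nat.card (En ⧸ Submodule.span R {un}) := by
  rw [← natCard_torsionBy_eq_natCard_quotient_smul_top ω,
    natCard_torsionBy_quotient_eq hω hν hE hu j hj hjω hjr hun]

end Counts

end Summit.BirchSwinnertonDyer.BirchSwinnertonDyer.Theorems.SignedMuAtTwo.NonsquareDescent
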